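import Summits.BirchSwinnertonDyer.BirchSwinnertonDyer.Theorems.UniversalToricDescentTwinHowardSettingSatisfiesH
import Summits.BirchSwinnertonDyer.BirchSwinnertonDyer.Theorems.UniversalToricDescentTwinH4AtSExactAtThree
import Summits.BirchSwinnertonDyer.BirchSwinnertonDyer.Theorems.UniversalToricDescentTwinH5bAtSThree
import Summits.BirchSwinnertonDyer.BirchSwinnertonDyer.Theorems.UniversalToricDescentTwinTateLineAtThree
import HarnessLib

/-!
# Howard's hypotheses `SatisfiesH` for the levels-tame Eisenstein setting of a curve with SURJECTIVE `ρ̄_{E,3}` and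
# MULTIPLICATIVE reduction above `3`, over an imaginary quadratic Heegner field, anticyclotomic tower — UNCONDITIONALLY
# (the E2 «H-twin» unit of the K2 stub of crux 24737, Summits-side assembly; THEOREMS ONLY: no definition, no named fact, no instance, no `sorry`)

Helper toward the registered stub `stub_howardOutputsOfFamily` (K2) of line `beta-road` (skeleton v10 cd44fe9d5c6b9a78) of crux r205
stmt-BirchSwinnertonDyer-24737 `…Theses.UniversalToricDescent.TwinAlgMuZeroAtThree` (LEAD lineage `bsd-wall-utd-p1`, g25).  The twin
of x10b's `HeegnerMuPartStubA.howardInputs_of_clauses` WITHOUT the Kolyvagin-system side: for `W/ℚ` elliptic with `ρ̄_{W,3}` onto, `K`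
imaginary quadratic satisfying the Heegner hypothesis for `N`, `κ` an anticyclotomic `ℤ₃`-extension, and MULTIPLICATIVE reduction of
`W_K` at every place above `3` (the twin `W′` of the universal-toric-descent route: `3 ∥ N′`), for every finite `Aut(K/ℚ)`-stable set `S`
of places with `{v ∣ 3} ⊆ S ⊆ {v ∣ 3N}` off which `W_K` has good reduction, there is `m₀` such that for all `m ≥ m₀`, all tame pins
`π`, all admissible `𝓛` off `S` and all `jbar`, the canonical conjugation datum and the Weil–τ H.4 data `D` make Howard's `SatisfiesH`
hold for `W.eisensteinDVRSettingLevelsTame (κ.unitTwist (-1)) hm π S … jbar (ofLifts σ …) D`: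
**`exists_satisfiesH_levelsTame_of_hasMultiplicativeReductionAt`** = setting data (p760719,
`…TwinHowardSettingSatisfiesH.…_unconditional`, Poitou–Tate discharged) + H.4 at every `v ∈ S`
(`…TwinH4AtSExactAtThree.h4AtThree_of_hasMultiplicativeReductionAt`, p761491) + H.5(b) at every level and every `v ∈ S`
(`…TwinH5bAtSThree.h5bAtThree_of_hasMultiplicativeReductionAt`).  No named-fact hypothesis remains.  What this is NOT: the Kolyvagin
system `κ^Hg` for the twin at `3 ∥ N′` (beyond print), Howard's Thm 1.6.1 engine output (F-161′), the readout/LINK — the rest of the K2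
stub.  Bookkeeping toward one stub of one crux; no summit statement is proved; BSD is not proved by any of this.
-/

set_option linter.dupNamespace false
set_option autoImplicit false

noncomputable section

open scoped Classical Pointwise ContRepresentation TensorProduct NumberField

open Function NumberField IsDedekindDomain Field
open Literature Literature.NumberTheory.EllipticCurves WeierstrassCurve
open Literature.NumberTheory.GaloisCohomology Literature.NumberTheory.GaloisCohomology.Howard2004
open Literature.NumberTheory.GaloisRepresentations Literature.NumberTheory.GaloisRepresentations.DiscreteGaloisModule
open Literature.NumberTheory.Automorphic
open Literature.NumberTheory.EllipticCurves.ZpExtension (EisensteinLevel)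
open Summit.BirchSwinnertonDyer.BirchSwinnertonDyer.Theorems


namespace Summit.BirchSwinnertonDyer.BirchSwinnertonDyer.Theorems.UniversalToricDescentTwinSatisfiesHAtThree

set_option synthInstance.maxHeartbeats 80000 in
set_option maxHeartbeats 1600000 in
/-- **Howard's `SatisfiesH` for the twin frame, unconditionally.**  `W/ℚ` elliptic with `ρ̄_{W,3}` onto, `K` imaginary quadratic Heegner
for `N`, `κ` anticyclotomic, multiplicative reduction of `W_K` above `3`, `S` as in the letters (`{v ∣ 3} ⊆ S ⊆ {v ∣ 3N}`, `Aut(K/ℚ)`-stable,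
good reduction off `S ∪ {v ∣ 3}`): for `m ≥ m₀(S)` and all `π`, `𝓛`, `jbar`, the canonical conjugation datum `ofLifts σ … (e c₀ e⁻¹) …` and
H.4 data `D` give `SatisfiesH` for the levels-tame Eisenstein DVR setting of `W_K` at `κ⁻ = κ.unitTwist (-1)`.
[cite: Howard2004HeegnerKolyvagin, §1.3 H.0–H.5 and §1.6 (arXiv:1202.6340 p. 7 L33 – p. 8 L1, p. 11 L13–38)]
[cite: MilneADT2006, Ch. I, Thm. 2.6 and Thm. 4.10(b)] -/
theorem exists_satisfiesH_levelsTame_of_hasMultiplicativeReductionAt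
    (N : ℕ) [NeZero N] (W : WeierstrassCurve ℚ) [W.IsElliptic] (K : Type) [Field K] [NumberField K]
    (κ : ZpExtension K 3) (hsurj : W.HasSurjectiveModNGaloisRep ((3 : ℕ) : ℤ))
    (hK : IsImaginaryQuadratic K) (hanti₀ : κ.IsAnticyclotomic) (hHeeg : SatisfiesHeegnerHypothesis N K)
    (hmultw : ∀ w : HeightOneSpectrum (𝓞 K), ((3 : ℕ) : 𝓞 K) ∈ w.asIdeal → (W.baseChange K).HasMultiplicativeReductionAt w)
    (S : Finset (HeightOneSpectrum (𝓞 K)))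
    (hpS : ∀ v, ((3 : ℕ) : 𝓞 K) ∈ v.asIdeal → v ∈ S)
    (hbad : ∀ v, v ∉ S → ((3 : ℕ) : 𝓞 K) ∉ v.asIdeal → (W.baseChange K).HasGoodReductionAt v)
    (hSN : ∀ v ∈ S, ((3 : ℕ) : 𝓞 K) ∈ v.asIdeal ∨ ((N : ℕ) : 𝓞 K) ∈ v.asIdeal)
    (hSσ : ∀ (σ : K ≃ₐ[ℚ] K) (v : HeightOneSpectrum (𝓞 K)), σ • v ∈ S → v ∈ S) :
    ∃ m₀ : ℕ, ∀ (m : ℕ) (hm : 1 ≤ m), m₀ ≤ m →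
      letI := IwasawaAlgebra.isDomain_quotient_X_pow_add_C 3 hm
      letI := IwasawaAlgebra.isDiscreteValuationRing_quotient_X_pow_add_C 3 hm
      haveI := IwasawaAlgebra.EisensteinCoeff.isLocalRing_succ 3 hm
      letI := IwasawaAlgebra.EisensteinCoeff.algebraOfSpecSucc 3 m
      haveI := W.isScalarTower_algebraOfSpecSucc (K := K) (p := 3) (m := m)
      letI := W.residueModuleSucc (K := K) (p := 3) hm
      ∀ (π : ∀ v : HeightOneSpectrum (𝓞 K), TamePin v) (L : Set (HeightOneSpectrum (𝓞 K)))
        (hL : L ⊆ (W.eisensteinTower (κ.unitTwist (-1)) hm).degreeTwoPrimes 3) (hLS : ∀ v ∈ L, v ∉ S)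
        (jbar : AlgebraicClosure K →+* ℂ),
        ∃ (c₀ : absoluteGaloisGroup ℚ) (σ : K ≃ₐ[ℚ] K) (hσ₁ : σ ≠ 1) (hσ : σ * σ = 1)
          (hτl : IsLiftOfAut σ (absGaloisTransport (K := ℚ) (L := K) c₀).toRingEquiv)
          (hτ₂ : Function.Involutive (absGaloisTransport (K := ℚ) (L := K) c₀).toRingEquiv)
          (D : ∀ k, DualityDatum 3 (ConjugationDatum.ofLifts σ hσ₁ hσ _ hτl hτ₂)
            ((W.eisensteinTower (κ.unitTwist (-1)) hm).ρ k) (IwasawaAlgebra.EisensteinCoeff 3 m (k + 1))),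
          (W.eisensteinDVRSettingLevelsTame (κ.unitTwist (-1)) hm π S hpS hbad L hL hLS jbar
            (ConjugationDatum.ofLifts σ hσ₁ hσ _ hτl hτ₂) D).SatisfiesH := by
  obtain ⟨m₄, hH4⟩ := UniversalToricDescentTwinH4AtSExactAtThree.h4AtThree_of_hasMultiplicativeReductionAt N W K κ hK hanti₀
    hHeeg hmultw S hpS hbad hSN hSσ
  obtain ⟨m₅, hH5⟩ := UniversalToricDescentTwinH5bAtSThree.h5bAtThree_of_hasMultiplicativeReductionAt N W K κ hK hanti₀ hHeeg
    hmultw S hpS hbad hSN hSσ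
  refine ⟨max m₄ m₅, fun m hm hle ↦ ?_⟩
  have hm4 : m₄ ≤ m := le_trans (le_max_left _ _) hle
  have hm5 : m₅ ≤ m := le_trans (le_max_right _ _) hle
  letI := IwasawaAlgebra.isDomain_quotient_X_pow_add_C 3 hm
  letI := IwasawaAlgebra.isDiscreteValuationRing_quotient_X_pow_add_C 3 hm
  haveI := IwasawaAlgebra.EisensteinCoeff.isLocalRing_succ 3 hm
  letI := IwasawaAlgebra.EisensteinCoeff.algebraOfSpecSucc 3 m
  haveI := W.isScalarTower_algebraOfSpecSucc (K := K) (p := 3) (m := m)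
  letI := W.residueModuleSucc (K := K) (p := 3) hm
  intro π L hL hLS jbar
  -- D1: conjugation datum, H.4 data, `SatisfiesH` modulo the `v ∈ S` clauses (Poitou–Tate discharged)
  obtain ⟨c₀, σ, hσ₁, hσ, hτl, hτ₂, Dd, e, log, hc₀, hτ, hDe, he_red, h4', h5', h6', h7', h8', h9', hyOf⟩ :=
    UniversalToricDescentTwinHowardSettingSatisfiesH.exists_eisensteinSettingData_satisfiesH_eRed_of_hasSurjectiveModNGaloisRep_unconditional
      (W := W) (K := K) (κ := κ.unitTwist (-1)) (p := 3) (by decide) hsurj hK (hanti₀.unitTwist (-1)) hm π S hpS hbad hSσ L hL hLS jbar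
  have hfin4 := hH4 m hm hm4 L hL hLS c₀ σ hσ₁ hσ hτl hτ₂ Dd e log hc₀ hτ hDe he_red h4' h5' h6' h7' h8' h9'
  have hfin5b := hH5 m hm hm5 π L hL hLS jbar c₀ σ hσ₁ hσ hτl hτ₂ Dd e log hc₀ hτ hDe h4' h5' h6' h7' h8' h9'
  exact ⟨c₀, σ, hσ₁, hσ, hτl, hτ₂, Dd, hyOf hfin4 hfin5b⟩

set_option synthInstance.maxHeartbeats 80000 in
set_option maxHeartbeats 1600000 in
/-- **The same, in the binders of crux 24737** (`TwinAlgMuZeroAtThree`, K2 branch `Mult W′ 3`): for the twin `W′/ℚ` with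
`ρ̄_{W′,3}` onto (`W′.HasSurjectiveModNGaloisRep 3`) and multiplicative reduction at `3` (`Rank1Residual.Mult W′ 3` — so `W′_K` has
multiplicative reduction at every place above `3`, `UniversalToricDescentTwinTateLineAtThree.hasMultiplicativeReductionAt_baseChange_of_mult_three`),
`K` imaginary quadratic Heegner for `N′`, `κ` anticyclotomic: Howard's `SatisfiesH` for the levels-tame Eisenstein setting at `κ⁻`, for
`m ≫ 0`, unconditionally. [cite: Howard2004HeegnerKolyvagin, §1.3 H.0–H.5 and §1.6 (arXiv:1202.6340 p. 7 L33 – p. 8 L1)]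
[cite: MilneADT2006, Ch. I, Thm. 2.6 and Thm. 4.10(b)] -/
theorem exists_satisfiesH_levelsTame_of_mult_three
    (N' : ℕ) [NeZero N'] (W' : WeierstrassCurve ℚ) [W'.IsElliptic] (K : Type) [Field K] [NumberField K]
    (κ : ZpExtension K 3) (hm3 : Rank1Residual.Mult W' 3) (hsurj : W'.HasSurjectiveModNGaloisRep 3)
    (hK : IsImaginaryQuadratic K) (hH : SatisfiesHeegnerHypothesis N' K) (hanti : κ.IsAnticyclotomic)
    (S : Finset (HeightOneSpectrum (𝓞 K)))
    (hpS : ∀ v, ((3 : ℕ) : 𝓞 K) ∈ v.asIdeal → v ∈ S)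
    (hbad : ∀ v, v ∉ S → ((3 : ℕ) : 𝓞 K) ∉ v.asIdeal → (W'.baseChange K).HasGoodReductionAt v)
    (hSN : ∀ v ∈ S, ((3 : ℕ) : 𝓞 K) ∈ v.asIdeal ∨ ((N' : ℕ) : 𝓞 K) ∈ v.asIdeal)
    (hSσ : ∀ (σ : K ≃ₐ[ℚ] K) (v : HeightOneSpectrum (𝓞 K)), σ • v ∈ S → v ∈ S) :
    ∃ m₀ : ℕ, ∀ (m : ℕ) (hm : 1 ≤ m), m₀ ≤ m →
      letI := IwasawaAlgebra.isDomain_quotient_X_pow_add_C 3 hm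
      letI := IwasawaAlgebra.isDiscreteValuationRing_quotient_X_pow_add_C 3 hm
      haveI := IwasawaAlgebra.EisensteinCoeff.isLocalRing_succ 3 hm
      letI := IwasawaAlgebra.EisensteinCoeff.algebraOfSpecSucc 3 m
      haveI := W'.isScalarTower_algebraOfSpecSucc (K := K) (p := 3) (m := m)
      letI := W'.residueModuleSucc (K := K) (p := 3) hm
      ∀ (π : ∀ v : HeightOneSpectrum (𝓞 K), TamePin v) (L : Set (HeightOneSpectrum (𝓞 K)))
        (hL : L ⊆ (W'.eisensteinTower (κ.unitTwist (-1)) hm).degreeTwoPrimes 3) (hLS : ∀ v ∈ L, v ∉ S)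
        (jbar : AlgebraicClosure K →+* ℂ),
        ∃ (c₀ : absoluteGaloisGroup ℚ) (σ : K ≃ₐ[ℚ] K) (hσ₁ : σ ≠ 1) (hσ : σ * σ = 1)
          (hτl : IsLiftOfAut σ (absGaloisTransport (K := ℚ) (L := K) c₀).toRingEquiv)
          (hτ₂ : Function.Involutive (absGaloisTransport (K := ℚ) (L := K) c₀).toRingEquiv)
          (D : ∀ k, DualityDatum 3 (ConjugationDatum.ofLifts σ hσ₁ hσ _ hτl hτ₂)
            ((W'.eisensteinTower (κ.unitTwist (-1)) hm).ρ k) (IwasawaAlgebra.EisensteinCoeff 3 m (k + 1))),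
          (W'.eisensteinDVRSettingLevelsTame (κ.unitTwist (-1)) hm π S hpS hbad L hL hLS jbar
            (ConjugationDatum.ofLifts σ hσ₁ hσ _ hτl hτ₂) D).SatisfiesH :=
  exists_satisfiesH_levelsTame_of_hasMultiplicativeReductionAt N' W' K κ hsurj hK hanti hH
    (fun w hw ↦ UniversalToricDescentTwinTateLineAtThree.hasMultiplicativeReductionAt_baseChange_of_mult_three W' hm3 K w hw)
    S hpS hbad hSN hSσ

end Summit.BirchSwinnertonDyer.BirchSwinnertonDyer.Theorems.UniversalToricDescentTwinSatisfiesHAtThree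

end
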